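import Mathlib
import Literature.Probability.Percolation.SmoothedWhiteNoise
import Literature.Probability.Percolation.Crossings
import Literature.Probability.Percolation.PlanarDuality
import Literature.Probability.LatticeModels.ProductMeasureTools
import Summits.CriticalPhenomena.CardyFormulaZ2.Theorems.CardyWhiteToColouredNoiseDiscretisationSignMeasurable
import Summits.CriticalPhenomena.CardyFormulaZ2.Theorems.CardyWhiteToColouredNoiseDiscretisationTail

/-!
# Stub stub_signLawSelfDual — exact self-duality of the sign law (line `birth` of `DriftBound`)

Helper file for crux item `DriftBound` (stmt-CriticalPhenomena-4596) of route
`CardyWhiteToColoured` (`CardyFormulaZ2`), stub S4a of the registered line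
`Cruxes/DriftBound/Lines/birth.lean`.

For `σ > 0` the planar dual (`dualConfig`, dual vertices labelled by lower-left corners) of the
sign configuration `signConfig σ 1 ξ = {e ∈ E(ℤ²) | (k_σ ⋆ ξ)(m_1 e) > 0}` of the
Gaussian-smoothed lattice white noise has the same law as the sign configuration itself:
`(signConfigLaw σ 1).map dualConfig = signConfigLaw σ 1`.

* Geometry: `medialPoint 1 e = medialPoint 1 (dualEdge e) + (1/2, 1/2)` for every lattice edge
  (`sd_medialPoint_dualEdge`), so with `ψ f` the primal edge crossed by the dual edge `f`
  (a permutation of `E(ℤ²)`, `sd_exists_equiv`) and `Φ ξ = (f ↦ −ξ (ψ f))`, the smoothed field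
  satisfies `F(Φ ξ)(x) = −F(ξ)(x + (1/2, 1/2))` termwise (`sd_smoothedNoise_neg_reindex`),
  whence `dualConfig (signConfig σ 1 ξ) = signConfig σ 1 (Φ ξ)` as soon as no smoothed value at
  a medial point vanishes (`sd_dualConfig_signConfig`).
* No ties: at every point `x` the smoothed field is almost surely non-zero
  (`sd_ae_smoothedNoise_ne_zero`): resampling one coordinate `ξ_{e₀}`
  (`map_update_infinitePi_prod`) and Fubini, the field is affine in `ξ_{e₀}` with slope
  `k_σ(x − m e₀) > 0` once the kernel series converges absolutely (almost surely,
  `sd_ae_summable`), and `N(0,1)` has no atoms.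
* Invariance: `Φ` preserves the white noise (coordinate permutation and `ξ ↦ −ξ`,
  `sd_map_neg_reindex`), so
  `map dualConfig ∘ signConfig = map signConfig ∘ Φ = map signConfig`.

References: G. Grimmett, *Percolation* (1999), §11.2 (planar duality of bond percolation on
`ℤ²`); S. Muirhead, H. Vanneuville, Ann. Inst. H. Poincaré Probab. Stat. 56 (2020), §2.1.
-/

noncomputable section

namespace Summit.CriticalPhenomena.CardyFormulaZ2.Cruxes.DriftBound.Birth

open Set Filter Topology MeasureTheory ProbabilityTheory
open scoped ENNReal NNReal
open Literature.Probability.LatticeModels Literature.Probability.Percolation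
open Summit.CriticalPhenomena.CardyFormulaZ2.Theorems.WhiteToColoured

/-! ### Geometry of the medial points of dual edges -/

/-- The shift `(1/2, 1/2)` between the medial point of an edge and that of its dual edge. -/
theorem sd_medialPoint_dualEdge {e : Sym2 (Site 2)} (he : e ∈ (zdGraph 2).edgeSet) :
    medialPoint 1 e = medialPoint 1 (dualEdge e) + ⟨1 / 2, 1 / 2⟩ := by
  obtain ⟨u, i, rfl⟩ := mem_edgeSet_zdGraph_iff.1 he
  fin_cases i
  · simp only [Fin.zero_eta]
    rw [dualEdge_horizontal]
    apply Complex.ext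
    · simp [Complex.div_ofNat_re]
      ring
    · simp [Complex.div_ofNat_im]
      ring
  · simp only [Fin.mk_one]
    rw [dualEdge_vertical]
    apply Complex.ext
    · simp [Complex.div_ofNat_re]
      ring
    · simp [Complex.div_ofNat_im]
      ring

/-- **The primal edge crossed by a dual edge**, as a permutation `ψ` of `E(ℤ²)`:
`dualEdge (ψ f) = f` and `medialPoint 1 (ψ f) = medialPoint 1 f + (1/2, 1/2)`. -/
theorem sd_exists_equiv :
    ∃ ψ : (zdGraph 2).edgeSet ≃ (zdGraph 2).edgeSet,
      (∀ f : (zdGraph 2).edgeSet, dualEdge (ψ f).1 = f.1) ∧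
      ∀ f : (zdGraph 2).edgeSet, medialPoint 1 (ψ f).1 = medialPoint 1 f.1 + ⟨1 / 2, 1 / 2⟩ := by
  have hiff : ∀ a : Sym2 (Site 2),
      a ∈ (zdGraph 2).edgeSet ↔ dualEdgeEquiv.symm a ∈ (zdGraph 2).edgeSet := by
    intro a
    rw [← dualEdge_mem_edgeSet_iff (dualEdgeEquiv.symm a),
      show dualEdge (dualEdgeEquiv.symm a) = a from dualEdgeEquiv.apply_symm_apply a]
  refine ⟨dualEdgeEquiv.symm.subtypeEquiv hiff, fun f => dualEdgeEquiv.apply_symm_apply f.1,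
    fun f => ?_⟩
  have ha : dualEdgeEquiv.symm f.1 ∈ (zdGraph 2).edgeSet := (hiff f.1).mp f.2
  have h := sd_medialPoint_dualEdge ha
  rw [show dualEdge (dualEdgeEquiv.symm f.1) = f.1 from dualEdgeEquiv.apply_symm_apply f.1] at h
  exact h

/-! ### The reindexed, negated noise -/

/-- **Termwise reindexing**: if `medialPoint 1 (ψ f) = medialPoint 1 f + c`, the smoothed field of
the noise `f ↦ −ξ (ψ f)` at `x` is minus the smoothed field of `ξ` at `x + c` (reindex the
unconditional sum by `ψ`; no summability needed). -/
theorem sd_smoothedNoise_neg_reindex (ψ : (zdGraph 2).edgeSet ≃ (zdGraph 2).edgeSet) (c : ℂ)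
    (hψ : ∀ f : (zdGraph 2).edgeSet, medialPoint 1 (ψ f).1 = medialPoint 1 f.1 + c) (ℓ : ℝ)
    (ξ : (zdGraph 2).edgeSet → ℝ) (x : ℂ) :
    smoothedNoise ℓ 1 (fun f => -ξ (ψ f)) x = -smoothedNoise ℓ 1 ξ (x + c) := by
  show (∑' e' : (zdGraph 2).edgeSet,
      Real.exp (-(‖x - medialPoint 1 e'.1‖ ^ 2) / (2 * ℓ ^ 2)) * -ξ (ψ e')) =
    -∑' f : (zdGraph 2).edgeSet,
      Real.exp (-(‖x + c - medialPoint 1 f.1‖ ^ 2) / (2 * ℓ ^ 2)) * ξ f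
  rw [← tsum_neg]
  calc (∑' e' : (zdGraph 2).edgeSet,
        Real.exp (-(‖x - medialPoint 1 e'.1‖ ^ 2) / (2 * ℓ ^ 2)) * -ξ (ψ e'))
      = ∑' e' : (zdGraph 2).edgeSet,
          -(Real.exp (-(‖x + c - medialPoint 1 (ψ e').1‖ ^ 2) / (2 * ℓ ^ 2)) * ξ (ψ e')) := by
        refine tsum_congr fun e' => ?_
        rw [hψ e', show x + c - (medialPoint 1 e'.1 + c) = x - medialPoint 1 e'.1 by ring]
        ring
    _ = ∑' f : (zdGraph 2).edgeSet,
          -(Real.exp (-(‖x + c - medialPoint 1 f.1‖ ^ 2) / (2 * ℓ ^ 2)) * ξ f) :=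
        Equiv.tsum_eq ψ (fun f : (zdGraph 2).edgeSet =>
          -(Real.exp (-(‖x + c - medialPoint 1 f.1‖ ^ 2) / (2 * ℓ ^ 2)) * ξ f))

/-- **Pointwise duality without ties**: if `ψ f` is the primal edge crossed by `f` and is shifted
by `c` at the level of medial points, and no smoothed value of `ξ` at a medial point vanishes,
then the dual of the sign configuration of `ξ` is the sign configuration of `f ↦ −ξ (ψ f)`. -/
theorem sd_dualConfig_signConfig (ψ : (zdGraph 2).edgeSet ≃ (zdGraph 2).edgeSet) (c : ℂ)
    (hψE : ∀ f : (zdGraph 2).edgeSet, dualEdge (ψ f).1 = f.1)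
    (hψ : ∀ f : (zdGraph 2).edgeSet, medialPoint 1 (ψ f).1 = medialPoint 1 f.1 + c) {ℓ : ℝ}
    {ξ : (zdGraph 2).edgeSet → ℝ}
    (hties : ∀ e : (zdGraph 2).edgeSet, smoothedNoise ℓ 1 ξ (medialPoint 1 e.1) ≠ 0) :
    dualConfig (signConfig ℓ 1 ξ) = signConfig ℓ 1 (fun f => -ξ (ψ f)) := by
  ext f
  rw [dualConfig_eq, mem_setOf_eq, mem_signConfig_iff, mem_signConfig_iff,
    sd_smoothedNoise_neg_reindex ψ c hψ]
  refine and_congr_right fun hf => ?_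
  have h1 : dualEdgeEquiv.symm f = (ψ ⟨f, hf⟩).1 := by
    apply dualEdgeEquiv.injective
    rw [Equiv.apply_symm_apply, dualEdgeEquiv_apply, hψE]
  have h2 : medialPoint 1 f + c = medialPoint 1 (ψ ⟨f, hf⟩).1 := (hψ ⟨f, hf⟩).symm
  rw [h1, h2]
  have hne := hties (ψ ⟨f, hf⟩)
  simp only [(ψ ⟨f, hf⟩).2, true_and, not_lt, neg_pos]
  exact ⟨fun h => lt_of_le_of_ne h hne, le_of_lt⟩

/-- **Invariance of the white noise**: relabelling the i.i.d. `N(0,1)` coordinates by a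
permutation of `E(ℤ²)` and changing all signs preserves `latticeWhiteNoise`. -/
theorem sd_map_neg_reindex (ψ : (zdGraph 2).edgeSet ≃ (zdGraph 2).edgeSet) :
    latticeWhiteNoise.map (fun (ξ : (zdGraph 2).edgeSet → ℝ) (f : (zdGraph 2).edgeSet) =>
      -ξ (ψ f)) = latticeWhiteNoise := by
  have h1 : (fun (ξ : (zdGraph 2).edgeSet → ℝ) (f : (zdGraph 2).edgeSet) => -ξ (ψ f)) =
      (fun (ξ : (zdGraph 2).edgeSet → ℝ) (f : (zdGraph 2).edgeSet) => -ξ f) ∘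
        fun (ξ : (zdGraph 2).edgeSet → ℝ) (f : (zdGraph 2).edgeSet) => ξ (ψ f) := rfl
  have hm1 : Measurable fun (ξ : (zdGraph 2).edgeSet → ℝ) (f : (zdGraph 2).edgeSet) => ξ (ψ f) :=
    measurable_pi_lambda _ fun f => measurable_pi_apply _
  have hm2 : Measurable fun (ξ : (zdGraph 2).edgeSet → ℝ) (f : (zdGraph 2).edgeSet) => -ξ f :=
    measurable_pi_lambda _ fun f => (measurable_pi_apply f).neg
  rw [h1, ← Measure.map_map hm2 hm1, latticeWhiteNoise,
    map_reindex_infinitePi (gaussianReal 0 1) ψ]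
  refine map_pi_infinitePi (gaussianReal 0 1) (f := fun _ y => -y) (fun _ => measurable_neg)
    fun _ => ?_
  rw [gaussianReal_map_neg, neg_zero]

/-! ### No ties: the smoothed field at a point is almost surely non-zero -/

/-- The lattice sum of the Gaussian kernel of width `ℓ > 0` at mesh `1` converges. -/
theorem sd_summable_gaussWeight {ℓ : ℝ} (hℓ : 0 < ℓ) (x : ℂ) :
    Summable fun e : (zdGraph 2).edgeSet => gaussWeight ℓ (x - medialPoint 1 e.1) := by
  rcases le_or_gt 1 ℓ with h | h
  · exact summable_gaussWeight_medial hℓ one_pos h x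
  · refine (summable_gaussWeight_medial one_pos one_pos le_rfl x).of_nonneg_of_le
      (fun e => (gaussWeight_pos ℓ _).le) fun e => ?_
    unfold gaussWeight
    refine Real.exp_le_exp.2 ?_
    rw [neg_div, neg_div, neg_le_neg_iff]
    exact div_le_div_of_nonneg_left (sq_nonneg _) (by positivity) (by nlinarith)

/-- **Almost surely the kernel series converges absolutely against the noise**: its expected
absolute sum is `E|N(0,1)| · ∑' e', k_ℓ(x − m e') < ∞`. -/
theorem sd_ae_summable {ℓ : ℝ} (hℓ : 0 < ℓ) (x : ℂ) :
    ∀ᵐ ξ ∂latticeWhiteNoise,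
      Summable fun e' : (zdGraph 2).edgeSet => gaussWeight ℓ (x - medialPoint 1 e'.1) * ξ e' := by
  set Y : ((zdGraph 2).edgeSet → ℝ) → ℝ≥0∞ := fun ξ =>
    ∑' e' : (zdGraph 2).edgeSet, ‖gaussWeight ℓ (x - medialPoint 1 e'.1) * ξ e'‖ₑ with hY
  have hmeas : ∀ e' : (zdGraph 2).edgeSet, Measurable fun ξ : (zdGraph 2).edgeSet → ℝ =>
      ‖gaussWeight ℓ (x - medialPoint 1 e'.1) * ξ e'‖ₑ := fun e' =>
    (measurable_const.mul (measurable_pi_apply e')).enorm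
  have hYm : Measurable Y := Measurable.tsum hmeas
  have hYint : ∫⁻ ξ, Y ξ ∂latticeWhiteNoise ≠ ⊤ := by
    rw [hY, lintegral_tsum fun e' => (hmeas e').aemeasurable]
    have hle : ∀ e' : (zdGraph 2).edgeSet,
        ∫⁻ ξ, ‖gaussWeight ℓ (x - medialPoint 1 e'.1) * ξ e'‖ₑ ∂latticeWhiteNoise =
          ENNReal.ofReal (gaussWeight ℓ (x - medialPoint 1 e'.1)) *
            ∫⁻ ξ, ‖ξ e'‖ₑ ∂latticeWhiteNoise := by
      intro e'
      have : (fun ξ : (zdGraph 2).edgeSet → ℝ =>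
          ‖gaussWeight ℓ (x - medialPoint 1 e'.1) * ξ e'‖ₑ) =
          fun ξ => ENNReal.ofReal (gaussWeight ℓ (x - medialPoint 1 e'.1)) * ‖ξ e'‖ₑ := by
        funext ξ
        rw [enorm_mul, Real.enorm_eq_ofReal (gaussWeight_pos ℓ _).le]
      rw [this, lintegral_const_mul _ (measurable_pi_apply e').enorm]
    have hC : ∀ e' : (zdGraph 2).edgeSet,
        ∫⁻ ξ, ‖ξ e'‖ₑ ∂latticeWhiteNoise = ∫⁻ t : ℝ, ‖t‖ₑ ∂(gaussianReal 0 1) := fun e' =>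
      (measurePreserving_eval_infinitePi (fun _ : (zdGraph 2).edgeSet => gaussianReal 0 1)
        e').lintegral_comp measurable_enorm
    have hCfin : ∫⁻ t : ℝ, ‖t‖ₑ ∂(gaussianReal 0 1) ≠ ⊤ := by
      have hint : Integrable (id : ℝ → ℝ) (gaussianReal 0 1) :=
        memLp_one_iff_integrable.1 (memLp_id_gaussianReal' 1 ENNReal.one_ne_top)
      have hfin := hint.hasFiniteIntegral
      rw [HasFiniteIntegral] at hfin
      exact hfin.ne
    have hKtop : ∑' e' : (zdGraph 2).edgeSet,
        ENNReal.ofReal (gaussWeight ℓ (x - medialPoint 1 e'.1)) ≠ ⊤ := by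
      rw [← ENNReal.ofReal_tsum_of_nonneg (fun e' => (gaussWeight_pos ℓ _).le)
        (sd_summable_gaussWeight hℓ x)]
      exact ENNReal.ofReal_ne_top
    simp_rw [hle, hC]
    rw [ENNReal.tsum_mul_right]
    exact ENNReal.mul_ne_top hKtop hCfin
  filter_upwards [ae_lt_top hYm hYint] with ξ hξ
  have h1 : (∑' e' : (zdGraph 2).edgeSet,
      ((‖gaussWeight ℓ (x - medialPoint 1 e'.1) * ξ e'‖₊ : ℝ≥0) : ℝ≥0∞)) ≠ ⊤ := hξ.ne
  have h2 := NNReal.summable_coe.2 (ENNReal.tsum_coe_ne_top_iff_summable.1 h1)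
  exact Summable.of_norm (h2.congr fun e' => by simp only [coe_nnnorm])

/-- Resampling formula for a summable family: replacing the `i₀`-th term by `a`. -/
theorem sd_tsum_update {ι : Type*} [DecidableEq ι] {g : ι → ℝ} (hg : Summable g) (i₀ : ι)
    (a : ℝ) : ∑' i, Function.update g i₀ a i = a + ∑' i, if i = i₀ then 0 else g i := by
  rw [(hg.update i₀ a).tsum_eq_add_tsum_ite i₀, Function.update_self]
  congr 1
  refine tsum_congr fun i => ?_
  split_ifs with h
  · rfl
  · rw [Function.update_of_ne h]

/-- **No atom at a point**: for `ℓ > 0` and every `x`, the smoothed lattice white noise at `x` is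
almost surely non-zero. Resample one coordinate `ξ_{e₀}` (`map_update_infinitePi_prod`) and use
Fubini: for a noise whose kernel series converges (almost every one), the field at `x` is affine
in `ξ_{e₀}` with non-zero slope `k_ℓ(x − m e₀)`, so it vanishes for at most one value of
`ξ_{e₀}`, a null set for the atomless `N(0,1)`. -/
theorem sd_ae_smoothedNoise_ne_zero {ℓ : ℝ} (hℓ : 0 < ℓ) (x : ℂ) :
    ∀ᵐ ξ ∂latticeWhiteNoise, smoothedNoise ℓ 1 ξ x ≠ 0 := by
  classical
  set K : (zdGraph 2).edgeSet → ℝ := fun e' => gaussWeight ℓ (x - medialPoint 1 e'.1) with hK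
  have hF : ∀ ξ : (zdGraph 2).edgeSet → ℝ, smoothedNoise ℓ 1 ξ x = ∑' e', K e' * ξ e' :=
    fun ξ => rfl
  obtain ⟨e₀⟩ : Nonempty (zdGraph 2).edgeSet := ⟨⟨_, single_edge_mem 0 0⟩⟩
  haveI := nullSingletonClass_gaussianReal (μ := (0 : ℝ)) (v := 1) one_ne_zero
  set S : Set ((zdGraph 2).edgeSet → ℝ) := {ξ | smoothedNoise ℓ 1 ξ x = 0} with hS
  have hSm : MeasurableSet S := measurable_smoothedNoise ℓ 1 x (measurableSet_singleton 0)
  have hupdm : Measurable fun p : ((zdGraph 2).edgeSet → ℝ) × ℝ => Function.update p.1 e₀ p.2 :=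
    measurable_update'
  have hfib : ∀ᵐ ξ ∂latticeWhiteNoise, gaussianReal 0 1 (Prod.mk ξ ⁻¹'
      ((fun p : ((zdGraph 2).edgeSet → ℝ) × ℝ => Function.update p.1 e₀ p.2) ⁻¹' S)) = 0 := by
    filter_upwards [sd_ae_summable hℓ x] with ξ hξ
    apply Set.Subsingleton.measure_zero
    intro y hy y' hy'
    simp only [mem_preimage, hS, mem_setOf_eq, hF] at hy hy'
    have hupdate : ∀ t : ℝ, (fun e' => K e' * Function.update ξ e₀ t e') =
        Function.update (fun e' => K e' * ξ e') e₀ (K e₀ * t) := by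
      intro t
      funext e'
      by_cases h : e' = e₀
      · subst h; simp
      · simp [Function.update_of_ne h]
    rw [hupdate, sd_tsum_update hξ] at hy hy'
    have hK0 : K e₀ ≠ 0 := (gaussWeight_pos ℓ _).ne'
    exact mul_left_cancel₀ hK0 (by linarith)
  rw [ae_iff]
  simp only [not_not]
  change latticeWhiteNoise S = 0
  calc latticeWhiteNoise S
      = (((Measure.infinitePi fun _ : (zdGraph 2).edgeSet => gaussianReal 0 1).prod
          (gaussianReal 0 1)).map
          fun p : ((zdGraph 2).edgeSet → ℝ) × ℝ => Function.update p.1 e₀ p.2) S := by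
        rw [map_update_infinitePi_prod (fun _ : (zdGraph 2).edgeSet => gaussianReal 0 1) e₀]
        rfl
    _ = ((Measure.infinitePi fun _ : (zdGraph 2).edgeSet => gaussianReal 0 1).prod
          (gaussianReal 0 1))
          ((fun p : ((zdGraph 2).edgeSet → ℝ) × ℝ => Function.update p.1 e₀ p.2) ⁻¹' S) :=
        Measure.map_apply hupdm hSm
    _ = ∫⁻ ξ, gaussianReal 0 1 (Prod.mk ξ ⁻¹'
          ((fun p : ((zdGraph 2).edgeSet → ℝ) × ℝ => Function.update p.1 e₀ p.2) ⁻¹' S))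
            ∂(Measure.infinitePi fun _ : (zdGraph 2).edgeSet => gaussianReal 0 1) :=
        Measure.prod_apply (hupdm hSm)
    _ = ∫⁻ _ξ, 0 ∂(Measure.infinitePi fun _ : (zdGraph 2).edgeSet => gaussianReal 0 1) :=
        lintegral_congr_ae hfib
    _ = 0 := lintegral_zero

/-- **No ties, all edges at once**: for `ℓ > 0`, almost surely no smoothed value at a medial
point of `ℤ²` vanishes (countably many edges). -/
theorem sd_ae_noTie {ℓ : ℝ} (hℓ : 0 < ℓ) :
    ∀ᵐ ξ ∂latticeWhiteNoise,
      ∀ e : (zdGraph 2).edgeSet, smoothedNoise ℓ 1 ξ (medialPoint 1 e.1) ≠ 0 := by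
  rw [ae_all_iff]
  exact fun e => sd_ae_smoothedNoise_ne_zero hℓ _

/-! ### Assembly -/

/-- **Stub S4a — exact self-duality of the sign law.** For `σ > 0` the planar dual of the sign
configuration (dual edge open iff the primal edge it crosses is closed, dual vertices labelled by
lower-left corners, `dualConfig` of `Crossings.lean`) has the same law:
`(signConfigLaw σ 1).map dualConfig = signConfigLaw σ 1`. Proof: with `ψ f` the primal edge
crossed by `f` (`sd_exists_equiv`, `medialPoint 1 (ψ f) = medialPoint 1 f + (1/2, 1/2)`) and
`Φ ξ = (f ↦ −ξ (ψ f))`, almost surely (no ties, `sd_ae_noTie`)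
`dualConfig (signConfig σ 1 ξ) = signConfig σ 1 (Φ ξ)` (`sd_dualConfig_signConfig`), and `Φ`
preserves `latticeWhiteNoise` (`sd_map_neg_reindex`). -/
theorem stub_signLawSelfDual :
    ∀ σ : ℝ, 0 < σ →
      (Literature.Probability.Percolation.signConfigLaw σ 1).map
          Literature.Probability.Percolation.dualConfig =
        Literature.Probability.Percolation.signConfigLaw σ 1 := by
  intro σ hσ
  obtain ⟨ψ, hψE, hψ⟩ := sd_exists_equiv
  have hΦm : Measurable fun (ξ : (zdGraph 2).edgeSet → ℝ) (f : (zdGraph 2).edgeSet) =>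
      -ξ (ψ f) :=
    measurable_pi_lambda _ fun f => (measurable_pi_apply _).neg
  have hae : (dualConfig ∘ signConfig σ 1) =ᵐ[latticeWhiteNoise]
      (signConfig σ 1 ∘ fun (ξ : (zdGraph 2).edgeSet → ℝ) (f : (zdGraph 2).edgeSet) =>
        -ξ (ψ f)) := by
    filter_upwards [sd_ae_noTie hσ] with ξ hξ
    exact sd_dualConfig_signConfig ψ _ hψE hψ hξ
  rw [signConfigLaw, Measure.map_map measurable_dualConfig (measurable_signConfig σ 1),
    Measure.map_congr hae, ← Measure.map_map (measurable_signConfig σ 1) hΦm,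
    sd_map_neg_reindex ψ]

end Summit.CriticalPhenomena.CardyFormulaZ2.Cruxes.DriftBound.Birth

end
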